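import Summits.BirchSwinnertonDyer.BirchSwinnertonDyer.Theorems.GenusKolyvaginAtTwoKolyvaginRelationAtTwoLemma43
import HarnessLib

/-!
# Route `GenusKolyvaginAtTwo`: Kolyvagin's two Theorem-B EXCLUSIONS `d_K·(−|Δ|) ∉ ℚ²`,
# `d_K·(−2|Δ|) ∉ ℚ²` are AUTOMATIC on every Heegner field with ODD `d_K` (seat gk2-p2 g7; helper)

The supply crux `GenusPrimitiveSupplyAtTwo` (stmt-BirchSwinnertonDyer-22136) must exhibit `K` with odd
`d_K ≠ −3`, the Heegner hypothesis for `N_E`, AND the two exclusions of Kolyvagin's Theorem B₂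
`¬ IsSquare (d_K · (−|Δ_E|))`, `¬ IsSquare (d_K · (−2|Δ_E|))` (= `K ⊄ ℚ(E[4])`); the exactness crux
`KolyvaginExactAtTwo` (22137) carries them as binders. They cost NOTHING: by the Heegner hypothesis every
prime of `d_K` is prime to `N_E`, hence to the minimal discriminant (`not_isSquare_discr_mul_Δ_of_satisfiesHeegnerHypothesis`'s
coprimality step, p611840), an odd `d_K` is also prime to `2`, and an odd fundamental discriminant
(squarefree, `≡ 1 (mod 4)`, negative) times an integer prime to it is never a square (`= ±a²` would
force `d_K = −1`). So for odd `d_K`: `d_K · u · Δ_min ∉ ℚ²` for every `u ∈ {±1, ±2}`, in particular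
both exclusions, whatever the sign of `Δ`. (For `d_K = −4, −8` they are NOT automatic.) Helper theorems
only (no definition, no named fact, no `sorry`); nothing is closed here; BSD is not proved by any of this.
References: [Kolyvagin1989Izv] Thm. B (the field exclusions); [GrossLMS1991] §1 (Heegner hypothesis,
`D ≠ 3, 4`); [WZhang2014] §1 (hypotheses on `K`).
-/

set_option autoImplicit false
set_option linter.dupNamespace false

noncomputable section

open scoped Classical

namespace Summit.BirchSwinnertonDyer.BirchSwinnertonDyer.Theorems.GenusExact

open WeierstrassCurve Field NumberField
open Literature.NumberTheory.EllipticCurves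

variable (W : WeierstrassCurve ℚ) [W.IsElliptic] [W.IsGloballyMinimal] {K : Type} [Field K] [NumberField K]

/-- **`gcd(d_K, Δ_min) = 1` under the Heegner hypothesis**: a prime `q ∣ d_K` has `q ∤ N_W`
(`not_dvd_discr_of_satisfiesHeegnerHypothesis`), so `W` has good reduction at `q` and `q ∤ Δ_min`.
[cite: GrossLMS1991, §1 (p. 235: all prime factors of N split in K)] -/
theorem isCoprime_discr_minimalDiscriminantInt_of_satisfiesHeegnerHypothesis (hK : IsImaginaryQuadratic K)
    (hH : SatisfiesHeegnerHypothesis (W.conductorNorm ℤ) K) :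
    IsCoprime (NumberField.discr K) (minimalDiscriminantInt W) := by
  rw [Int.isCoprime_iff_gcd_eq_one, Int.gcd_eq_natAbs]
  refine Nat.Coprime.gcd_eq_one (Nat.coprime_of_dvd fun q hq hqd hqD ↦ ?_)
  haveI : Fact q.Prime := ⟨hq⟩
  have hbad : ¬ W.HasGoodReductionAtPrime q := fun hgood ↦
    not_dvd_minimalDiscriminantInt_of_hasGoodReductionAtPrime' W q hgood (Int.ofNat_dvd_left.mpr hqD)
  exact not_dvd_discr_of_satisfiesHeegnerHypothesis hK hH hq
    ((dvd_conductorNorm_iff_not_hasGoodReductionAtPrime (W := W) q).mpr hbad) (Int.ofNat_dvd_left.mpr hqd)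

omit [W.IsElliptic] [W.IsGloballyMinimal] in
/-- **An odd fundamental discriminant times an integer prime to it is not a square**: for `K` imaginary
quadratic with `d_K` odd (so `d_K ≡ 1 (mod 4)` squarefree, `d_K < 0`) and `x ∈ ℤ` with `gcd(d_K, x) = 1`,
`d_K · x ∉ ℚ²` (`Int.sq_of_isCoprime`: `d_K = −a²`, squarefree forces `d_K = −1 ≢ 1 (mod 4)`).
[cite: Kolyvagin1989Izv, Thm. B (the field exclusions)] -/
theorem not_isSquare_discr_mul_of_odd_of_isCoprime (hK : IsImaginaryQuadratic K)
    (hodd : Odd (NumberField.discr K)) {x : ℤ} (hcop : IsCoprime (NumberField.discr K) x) :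
    ¬ IsSquare ((NumberField.discr K : ℚ) * x) := by
  set d : ℤ := NumberField.discr K with hd
  intro hsq
  have hsqZ : IsSquare (d * x) := by
    rw [← Rat.isSquare_intCast_iff]; push_cast; exact hsq
  obtain ⟨m, hm⟩ := hsqZ
  obtain ⟨a, ha⟩ := Int.sq_of_isCoprime hcop (by rw [sq]; exact hm)
  have hdneg : d < 0 := hK.discr_neg
  have hda : d = -a ^ 2 := by
    rcases ha with ha | ha
    · exfalso; nlinarith [sq_nonneg a]
    · exact ha
  rcases Literature.NumberTheory.QuadraticFields.Quadratic.isFundamentalDiscriminant_discr (K := K) hK.1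
    with ⟨h1, hsf, -⟩ | ⟨h4, -, -⟩
  · have hsf' : Squarefree d := hsf
    have hunit : IsUnit a := hsf' a ⟨-1, by rw [hda]; ring⟩
    have hd1 : d = -1 := by
      rcases Int.isUnit_iff.mp hunit with rfl | rfl <;> simpa using hda
    have h1' : d % 4 = 1 := h1
    omega
  · obtain ⟨k, hk⟩ := hodd
    have h4' : (4 : ℤ) ∣ d := h4
    omega

/-- **Both Theorem-B exclusions, and their sign variants, are free on Heegner fields with odd `d_K`**: for
`W/ℚ` globally minimal, `K` imaginary quadratic with odd `d_K` and the Heegner hypothesis for `N_W`, and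
any `u ∈ ℤ` prime to `d_K` (e.g. `u ∈ {±1, ±2}`): `d_K · (u · Δ_W) ∉ ℚ²`. [cite: Kolyvagin1989Izv, Thm. B] [cite: GrossLMS1991, §1] -/
theorem not_isSquare_discr_mul_mul_Δ_of_odd (hK : IsImaginaryQuadratic K) (hodd : Odd (NumberField.discr K))
    (hH : SatisfiesHeegnerHypothesis (W.conductorNorm ℤ) K) {u : ℤ} (hu : IsCoprime (NumberField.discr K) u) :
    ¬ IsSquare ((NumberField.discr K : ℚ) * (u * W.Δ)) := by
  have hcop : IsCoprime (NumberField.discr K) (u * minimalDiscriminantInt W) :=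
    IsCoprime.mul_right hu (isCoprime_discr_minimalDiscriminantInt_of_satisfiesHeegnerHypothesis W hK hH)
  have h := not_isSquare_discr_mul_of_odd_of_isCoprime hK hodd hcop
  rwa [Int.cast_mul, cast_minimalDiscriminantInt] at h

/-- **Kolyvagin's first exclusion `¬ IsSquare (d_K · (−|Δ_W|))` is automatic** for `K` imaginary quadratic
with odd `d_K` satisfying the Heegner hypothesis for `N_W` (`W` globally minimal; any sign of `Δ`) — the
binder of `KolyvaginExactAtTwo` (22137), of the repaired Q5′, and a conjunct of the supply crux
`GenusPrimitiveSupplyAtTwo` (22136). [cite: Kolyvagin1989Izv, Thm. B (K ≠ ℚ(√−|Δ|))] [cite: GrossLMS1991, §1] -/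
theorem not_isSquare_discr_mul_neg_abs_Δ_of_odd (hK : IsImaginaryQuadratic K)
    (hodd : Odd (NumberField.discr K)) (hH : SatisfiesHeegnerHypothesis (W.conductorNorm ℤ) K) :
    ¬ IsSquare ((NumberField.discr K : ℚ) * -|W.Δ|) := by
  rcases abs_choice W.Δ with h | h
  · rw [h, show -W.Δ = ((-1 : ℤ) : ℚ) * W.Δ by push_cast; ring]
    exact not_isSquare_discr_mul_mul_Δ_of_odd W hK hodd hH isCoprime_one_right.neg_right
  · rw [h, neg_neg, show W.Δ = ((1 : ℤ) : ℚ) * W.Δ by push_cast; ring]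
    exact not_isSquare_discr_mul_mul_Δ_of_odd W hK hodd hH isCoprime_one_right

/-- **Kolyvagin's second exclusion `¬ IsSquare (d_K · (−2|Δ_W|))` is automatic** under the same
hypotheses (odd `d_K` is prime to `2`). [cite: Kolyvagin1989Izv, Thm. B (K ≠ ℚ(√−2|Δ|))] [cite: GrossLMS1991, §1] -/
theorem not_isSquare_discr_mul_neg_two_mul_abs_Δ_of_odd (hK : IsImaginaryQuadratic K)
    (hodd : Odd (NumberField.discr K)) (hH : SatisfiesHeegnerHypothesis (W.conductorNorm ℤ) K) :
    ¬ IsSquare ((NumberField.discr K : ℚ) * (-(2 * |W.Δ|))) := by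
  have h2 : IsCoprime (NumberField.discr K) 2 := Int.isCoprime_two_right.mpr hodd
  rcases abs_choice W.Δ with h | h
  · rw [h, show -(2 * W.Δ) = ((-2 : ℤ) : ℚ) * W.Δ by push_cast; ring]
    exact not_isSquare_discr_mul_mul_Δ_of_odd W hK hodd hH h2.neg_right
  · rw [h, show -(2 * -W.Δ) = ((2 : ℤ) : ℚ) * W.Δ by push_cast; ring]
    exact not_isSquare_discr_mul_mul_Δ_of_odd W hK hodd hH h2

/-- **The two Theorem-B exclusions in the binder shape of cruxes 22136 / 22137**, for every Heegner field
with odd `d_K`: `¬ IsSquare (d_K·(−|Δ|)) ∧ ¬ IsSquare (d_K·(−2|Δ|))`. So a supplier of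
`GenusPrimitiveSupplyAtTwo` only has to find `K` with odd `d_K ≠ −3`, the Heegner hypothesis and the
twin / descent data; and on Heegner fields with odd `d_K` the parent crux's two exclusion binders are idle.
[cite: Kolyvagin1989Izv, Thm. B] [cite: WZhang2014, §1 (hypotheses on K)] -/
theorem kolyvaginExclusions_of_odd_of_satisfiesHeegnerHypothesis (hK : IsImaginaryQuadratic K)
    (hodd : Odd (NumberField.discr K)) (hH : SatisfiesHeegnerHypothesis (W.conductorNorm ℤ) K) :
    ¬ IsSquare ((NumberField.discr K : ℚ) * -|W.Δ|) ∧
      ¬ IsSquare ((NumberField.discr K : ℚ) * (-(2 * |W.Δ|))) :=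
  ⟨not_isSquare_discr_mul_neg_abs_Δ_of_odd W hK hodd hH,
    not_isSquare_discr_mul_neg_two_mul_abs_Δ_of_odd W hK hodd hH⟩

end Summit.BirchSwinnertonDyer.BirchSwinnertonDyer.Theorems.GenusExact

end
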